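import Summits.BirchSwinnertonDyer.BirchSwinnertonDyer.Theorems.SylvesterTwoHeegnerIndexCMNormForm
import HarnessLib

/-!
# Route `SylvesterTwoHeegnerIndex` (rung K7t), THEOREM C step (C-d)₃, part 1 — `E₁[3]` of
# `E₁ : y² = x³ − 432` made KERNEL: the nine points, `3`-torsion, and «these are ALL of `E₁[3]`»

HONEST FRAMING (cell b2b-bsdres, seat x1b GEN 50 = O12 class lead; file `--supports
stmt-BirchSwinnertonDyer-19725 --as helper`, the facts-plus crux whose pending child is the cell's
THEOREM C `HSYPointTwoDivisibleSevenModNine`). MEMO-bsd-cm-two v2.8 §40.1 lists the proof of THEOREM C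
line by line; its step **(C-d)₃** — «torsion bookkeeping: `E₁[3] ⊂ E₁(K)` (`x ∈ {0, 12, 12ω, 12ω²}`);
`T ↦ T − [ω]T` maps `E₁[3]` ONTO `E₁[√−3] = ⟨(0, 12√−3)⟩`» — is recorded there as «CELL (finite check on
nine explicit points; not kernel)». This file and its sequel `…ThmCTorsionBookkeeping.lean` make it
KERNEL, for EVERY Weierstrass equation in Mordell form (`a₁ = a₂ = a₃ = a₄ = 0`) with `a₆ = −432` over
ANY field `F` with `2 ≠ 0`, `3 ≠ 0` and any `ω ∈ F` with `ω² + ω + 1 = 0`; `√−3 := 2ω + 1`. Here: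

* §0 scalar identities (`(2ω+1)² = −3`, `x³ − 1728 = (x − 12)(x − 12ω)(x − 12ω²)`, …);
* §1 the nine points `𝒪, (0, ±12√−3), (12ζ, ±36)` (`ζ ∈ {1, ω, ω²}`) lie on `E₁`
  (`nonsingular_zero_twelveSqrt`, `nonsingular_zero_neg_twelveSqrt`, `nonsingular_cubeRoot_thirtySix`,
  `nonsingular_cubeRoot_neg_thirtySix`, `twelve_pow_three`, `twelve_omega_pow_three`, `twelve_omegaSq_pow_three`);
* §2 they are `3`-torsion: `add_self_eq_neg_of_cube` (`2T = −T` when `x³ = 1728`: the tangent slope `L`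
  has `L·2y = 3x²`, `L² = 3x`), `three_nsmul_eq_zero_of_cube`, `three_nsmul_eq_zero_of_X_eq_zero`;
* §3 **they are ALL of `E₁[3]`**: `three_nsmul_eq_zero_iff` — an affine point `T = (x, y)` has `3•T = 0`
  iff `x = 0 ∨ x³ = 1728` (`⇒`: `2T = −T` forces `9x⁴ = 12x·y² = 12x(x³ − 432)`, i.e. `3x(x³ − 1728) = 0`),
  and then `eq_of_three_nsmul_eq_zero`: `(x, y) ∈ {(0, ±12√−3), (12ζ, ±36)}` — every `3`-torsion point
  over ANY extension is already rational over `ℚ(ω)`, the memo's «`E₁[3] ⊂ E₁(K)`».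

DEF-FREE (hypotheses `h1 … h4 : aᵢ = 0`, `h6 : a₆ = −432`), so it applies verbatim to
`(cubeSumCurve 1).baseChange K`. NO named fact, NO sorry, axioms standard. WHAT THIS IS NOT: not
THEOREM C (its Shimura-reciprocity steps (C-a), (C-b)₁, (C-b)₂ and HSY's printed Galois laws (C-d)₂ stay
PRINT/CELL, memo §40.2); nothing about `Ш`; closes no item; nothing booked; no label moves.
References: MEMO-bsd-cm-two v2.8 §15.5 (C-d), §40.1; [HuShuYin2019] p. 4 (`[ω](x,y) = (ωx, y)`), pp. 7–8
(the points `(0, 12√−3)`, `T = (12ω^{i+2}, −36) ∈ E₁[3]`); [SilvermanAEC2009] III.1, III.2.3 (group law).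
-/


set_option autoImplicit false
-- the Summit-side namespace `Summit.BirchSwinnertonDyer.BirchSwinnertonDyer.…` (summit = problem) is mandated by D-0017
set_option linter.dupNamespace false

noncomputable section

open scoped Classical

open WeierstrassCurve WeierstrassCurve.Affine WeierstrassCurve.Affine.Point

namespace Summit.BirchSwinnertonDyer.BirchSwinnertonDyer.Theorems.SylvesterTwoThmCTorsion

open SylvesterTwoCMNormForm

variable {F : Type*} [Field F] {W : WeierstrassCurve F} {ω : F}

/-! ## §0 Scalars: `ω`, `√−3 = 2ω + 1` -/

/-- `ω ≠ 1` as soon as `3 ≠ 0` in `F` (`1 + 1 + 1 ≠ 0`). [folklore] -/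
theorem omega_ne_one_of_three_ne_zero (hω : ω ^ 2 + ω + 1 = 0) (h3F : (3 : F) ≠ 0) : ω ≠ 1 := by
  rintro rfl
  apply h3F
  linear_combination hω

/-- `(2ω + 1)² = −3`: `2ω + 1` is a square root of `−3`. [folklore] -/
theorem sq_two_omega_add_one (hω : ω ^ 2 + ω + 1 = 0) : (2 * ω + 1) ^ 2 = -3 := by
  linear_combination 4 * hω

/-- `2ω + 1 ≠ 0` when `3 ≠ 0`. [folklore] -/
theorem two_omega_add_one_ne_zero (hω : ω ^ 2 + ω + 1 = 0) (h3F : (3 : F) ≠ 0) : 2 * ω + 1 ≠ 0 := by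
  intro h
  apply h3F
  have h' : (2 * ω + 1) ^ 2 = 0 := by rw [h]; ring
  linear_combination -h' + 4 * hω

/-- `(1 − ω)(1 − ω²) = 3`. [folklore] -/
theorem one_sub_omega_mul (hω : ω ^ 2 + ω + 1 = 0) : (1 - ω) * (1 - ω ^ 2) = 3 := by
  linear_combination (ω - 2) * hω

/-- `1 − ω ≠ 0` when `3 ≠ 0`. [folklore] -/
theorem one_sub_omega_ne_zero (hω : ω ^ 2 + ω + 1 = 0) (h3F : (3 : F) ≠ 0) : 1 - ω ≠ 0 :=
  sub_ne_zero.mpr (omega_ne_one_of_three_ne_zero hω h3F).symm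

/-- `x³ − 1728 = (x − 12)(x − 12ω)(x − 12ω²)`. [folklore] -/
theorem cube_sub_factor (hω : ω ^ 2 + ω + 1 = 0) (x : F) :
    x ^ 3 - 1728 = (x - 12) * (x - 12 * ω) * (x - 12 * ω ^ 2) := by
  linear_combination (12 * x ^ 2 - 144 * x * ω + 1728 * ω - 1728) * hω

/-- `x³ = 1728 ↔ x ∈ {12, 12ω, 12ω²}` over a field containing `ω`. [folklore] -/
theorem cube_eq_iff (hω : ω ^ 2 + ω + 1 = 0) (x : F) :
    x ^ 3 = 1728 ↔ x = 12 ∨ x = 12 * ω ∨ x = 12 * ω ^ 2 := by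
  rw [← sub_eq_zero, cube_sub_factor hω, mul_eq_zero, mul_eq_zero, sub_eq_zero, sub_eq_zero,
    sub_eq_zero, or_assoc]

/-! ## §1 The nine points lie on `E₁ : y² = x³ − 432` -/

section Points

variable (h2F : (2 : F) ≠ 0) (h1 : W.a₁ = 0) (h2 : W.a₂ = 0) (h3 : W.a₃ = 0) (h4 : W.a₄ = 0)
  (h6 : W.a₆ = -432)

include h1 h2 h3 h4 h6 in
/-- On a Mordell equation with `a₆ = −432`, `(x, y)` is ON the curve iff `y² = x³ − 432`. [folklore] -/
theorem equation_iff_mordell (x y : F) : W.toAffine.Equation x y ↔ y ^ 2 = x ^ 3 - 432 := by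
  rw [Affine.equation_iff]
  simp only [h1, h2, h3, h4, h6, zero_mul, add_zero]
  constructor <;> intro h <;> linear_combination h

include h2F h1 h2 h3 h4 h6 in
/-- A point of `y² = x³ − 432` with `y ≠ 0` is nonsingular (`∂/∂y = 2y ≠ 0`). [cite: SilvermanAEC2009, III.1] -/
theorem nonsingular_of_Y_ne_zero {x y : F} (heq : y ^ 2 = x ^ 3 - 432) (hy : y ≠ 0) :
    W.toAffine.Nonsingular x y := by
  rw [Affine.nonsingular_iff, Affine.equation_iff]
  simp only [h1, h2, h3, h4, h6, zero_mul, mul_zero, add_zero, sub_zero]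
  refine ⟨by linear_combination heq, Or.inr ?_⟩
  intro h
  apply hy
  have : (2 : F) * y = 0 := by linear_combination h
  rcases mul_eq_zero.mp this with h' | h'
  · exact absurd h' h2F
  · exact h'

include h1 h2 h3 h4 h6 in
/-- The ordinate of an affine point of `y² = x³ − 432` above `x = 0` is `±12√−3 = ±12(2ω+1)`. [folklore] -/
theorem Y_of_X_eq_zero (hω : ω ^ 2 + ω + 1 = 0) {y : F} (heq : W.toAffine.Equation 0 y) :
    y = 12 * (2 * ω + 1) ∨ y = -(12 * (2 * ω + 1)) := by
  rw [equation_iff_mordell h1 h2 h3 h4 h6] at heq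
  have h : (y - 12 * (2 * ω + 1)) * (y + 12 * (2 * ω + 1)) = 0 := by
    linear_combination heq - 576 * hω
  rcases mul_eq_zero.mp h with h' | h'
  · exact Or.inl (by linear_combination h')
  · exact Or.inr (by linear_combination h')

include h1 h2 h3 h4 h6 in
/-- The ordinate of an affine point of `y² = x³ − 432` with `x³ = 1728` is `±36`. [folklore] -/
theorem Y_of_cube {x y : F} (heq : W.toAffine.Equation x y) (hx : x ^ 3 = 1728) :
    y = 36 ∨ y = -36 := by
  rw [equation_iff_mordell h1 h2 h3 h4 h6] at heq
  have h : (y - 36) * (y + 36) = 0 := by linear_combination heq + hx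
  rcases mul_eq_zero.mp h with h' | h'
  · exact Or.inl (by linear_combination h')
  · exact Or.inr (by linear_combination h')

include h2F in
/-- `12 ≠ 0` and `36 ≠ 0` in a field with `2, 3 ≠ 0`. [folklore] -/
theorem thirtySix_ne_zero (h3F : (3 : F) ≠ 0) : (12 : F) ≠ 0 ∧ (36 : F) ≠ 0 := by
  have h12 : (12 : F) ≠ 0 := by
    intro h
    apply h3F
    have : (2 : F) * 2 * 3 = 0 := by linear_combination h
    simpa [h2F] using this
  refine ⟨h12, ?_⟩
  intro h
  apply h3F
  have : (12 : F) * 3 = 0 := by linear_combination h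
  simpa [h12] using this

include h2F h1 h2 h3 h4 h6 in
/-- **`(0, 12√−3) ∈ E₁(F)`**, `√−3 = 2ω + 1` (`(12(2ω+1))² = 144·(−3) = −432`). [cite: HuShuYin2019, p. 7] -/
theorem nonsingular_zero_twelveSqrt (hω : ω ^ 2 + ω + 1 = 0) (h3F : (3 : F) ≠ 0) :
    W.toAffine.Nonsingular 0 (12 * (2 * ω + 1)) := by
  refine nonsingular_of_Y_ne_zero h2F h1 h2 h3 h4 h6 ?_ ?_
  · linear_combination 576 * hω
  · exact mul_ne_zero (thirtySix_ne_zero h2F h3F).1 (two_omega_add_one_ne_zero hω h3F)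

include h2F h1 h2 h3 h4 h6 in
/-- **`(0, −12√−3) ∈ E₁(F)`**. [cite: HuShuYin2019, p. 7] -/
theorem nonsingular_zero_neg_twelveSqrt (hω : ω ^ 2 + ω + 1 = 0) (h3F : (3 : F) ≠ 0) :
    W.toAffine.Nonsingular 0 (-(12 * (2 * ω + 1))) := by
  refine nonsingular_of_Y_ne_zero h2F h1 h2 h3 h4 h6 ?_ ?_
  · linear_combination 576 * hω
  · exact neg_ne_zero.mpr
      (mul_ne_zero (thirtySix_ne_zero h2F h3F).1 (two_omega_add_one_ne_zero hω h3F))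

include h2F h1 h2 h3 h4 h6 in
/-- **`(x, 36) ∈ E₁(F)` whenever `x³ = 1728`** (so for `x = 12, 12ω, 12ω²`): `36² = 1296 = 1728 − 432`.
[cite: HuShuYin2019, p. 8] -/
theorem nonsingular_cubeRoot_thirtySix (h3F : (3 : F) ≠ 0) {x : F} (hx : x ^ 3 = 1728) :
    W.toAffine.Nonsingular x 36 := by
  refine nonsingular_of_Y_ne_zero h2F h1 h2 h3 h4 h6 ?_ (thirtySix_ne_zero h2F h3F).2
  linear_combination -hx

include h2F h1 h2 h3 h4 h6 in
/-- **`(x, −36) ∈ E₁(F)` whenever `x³ = 1728`** — Hu–Shu–Yin's `T = (12ω^{i+2}, −36)`.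
[cite: HuShuYin2019, p. 8] -/
theorem nonsingular_cubeRoot_neg_thirtySix (h3F : (3 : F) ≠ 0) {x : F} (hx : x ^ 3 = 1728) :
    W.toAffine.Nonsingular x (-36) := by
  refine nonsingular_of_Y_ne_zero h2F h1 h2 h3 h4 h6 ?_
    (neg_ne_zero.mpr (thirtySix_ne_zero h2F h3F).2)
  linear_combination -hx

/-- `12³ = 1728`. [folklore] -/
theorem twelve_pow_three : (12 : F) ^ 3 = 1728 := by norm_num

/-- `(12ω)³ = 1728`. [folklore] -/
theorem twelve_omega_pow_three (hω : ω ^ 2 + ω + 1 = 0) : (12 * ω : F) ^ 3 = 1728 := by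
  linear_combination 1728 * (ω - 1) * hω

/-- `(12ω²)³ = 1728`. [folklore] -/
theorem twelve_omegaSq_pow_three (hω : ω ^ 2 + ω + 1 = 0) : (12 * ω ^ 2 : F) ^ 3 = 1728 := by
  linear_combination 1728 * (ω ^ 4 - ω ^ 3 + ω - 1) * hω

end Points

/-! ## §2 The nine points are `3`-torsion -/

section Torsion

variable (h2F : (2 : F) ≠ 0) (h3F : (3 : F) ≠ 0) (h1 : W.a₁ = 0) (h2 : W.a₂ = 0) (h3 : W.a₃ = 0)
  (h4 : W.a₄ = 0) (h6 : W.a₆ = -432)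

include h2F h3F h1 h2 h3 h4 h6

/-- `36² = 1296 ≠ 0`, so a point with `x³ = 1728` has `y ≠ 0`. [folklore] -/
theorem Y_ne_zero_of_cube {x y : F} (hp : W.toAffine.Nonsingular x y) (hx : x ^ 3 = 1728) : y ≠ 0 := by
  have h36 : (36 : F) ≠ 0 := (thirtySix_ne_zero h2F h3F).2
  rcases Y_of_cube h1 h2 h3 h4 h6 hp.left hx with rfl | rfl
  · exact h36
  · exact neg_ne_zero.mpr h36

omit h2F h3F h6 in
/-- The tangent slope at a point of `y² = x³ − 432` with `y ≠ −y` is `L` with `L·(2y) = 3x²`.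
[cite: SilvermanAEC2009, III.2.3] -/
theorem slope_self_mul {x y : F} (hy : y ≠ W.toAffine.negY x y) :
    W.toAffine.slope x x y y * (2 * y) = 3 * x ^ 2 := by
  have hden : y - W.toAffine.negY x y = 2 * y := by
    simp only [Affine.negY, h1, h3, sub_zero]
    ring
  have h2y : (2 : F) * y ≠ 0 := hden ▸ sub_ne_zero.mpr hy
  rw [Affine.slope_of_Y_ne rfl hy, hden]
  simp only [h1, h2, h4, mul_zero, zero_mul, add_zero, sub_zero]
  rw [div_mul_cancel₀ _ h2y]

omit h3F h2 h4 h6 in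
/-- `y ≠ −y = negY` for a point with `y ≠ 0` (as `2 ≠ 0`). [folklore] -/
theorem Y_ne_negY {x y : F} (hy : y ≠ 0) : y ≠ W.toAffine.negY x y := by
  intro h
  apply hy
  simp only [Affine.negY, h1, h3, sub_zero] at h
  have : (2 : F) * y = 0 := by linear_combination h
  rcases mul_eq_zero.mp this with h' | h'
  · exact absurd h' h2F
  · exact h'

/-- **`2T = −T` for `T = (x, y) ∈ E₁(F)` with `x³ = 1728`**: the tangent slope `L = 3x²/2y` has
`L² = 9x⁴/4y² = 9·1728x/(4·1296) = 3x`, so `x(2T) = L² − 2x = x` and `2T = −T`.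
[cite: SilvermanAEC2009, III.2.3] -/
theorem add_self_eq_neg_of_cube {x y : F} (hp : W.toAffine.Nonsingular x y) (hx : x ^ 3 = 1728) :
    (.some x y hp : W.toAffine.Point) + .some x y hp = -.some x y hp := by
  have heq := (equation_iff_mordell h1 h2 h3 h4 h6 x y).mp hp.left
  have hy := Y_ne_negY h2F h1 h3 (x := x) (Y_ne_zero_of_cube h2F h3F h1 h2 h3 h4 h6 hp hx)
  have hL := slope_self_mul h1 h2 h3 h4 hy
  set L := W.toAffine.slope x x y y with hLdef
  have hL2 : L ^ 2 = 3 * x := by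
    have e : (L * (2 * y)) ^ 2 = (3 * x ^ 2) ^ 2 := by rw [hL]
    have key : (L ^ 2 - 3 * x) * (4 * (x ^ 3 - 432)) = 0 := by
      linear_combination e - 4 * L ^ 2 * heq + (-(3 * x)) * hx
    have h4' : (4 : F) * (x ^ 3 - 432) ≠ 0 := by
      have h1296 : (1296 : F) ≠ 0 := by
        intro h
        apply h3F
        have : (2 : F) * 2 * 2 * 2 * 3 * 3 * 3 * 3 = 0 := by linear_combination h
        simpa [h2F] using this
      refine mul_ne_zero ?_ ?_
      · intro h
        apply h2F
        have : (2 : F) * 2 = 0 := by linear_combination h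
        simpa using this
      · intro h
        apply h1296
        linear_combination h - hx
    exact sub_eq_zero.mp ((mul_eq_zero.mp key).resolve_right h4')
  rw [Affine.Point.add_self_of_Y_ne' hy, neg_inj]
  simp only [Affine.addX, Affine.negAddY, h1, h2, sub_zero, Affine.Point.some.injEq]
  constructor
  · linear_combination hL2
  · linear_combination L * hL2

/-- `3•T = 0` for `T = (x, ±36)`, `x³ = 1728`. [cite: HuShuYin2019, p. 8] -/
theorem three_nsmul_eq_zero_of_cube {x y : F} (hp : W.toAffine.Nonsingular x y) (hx : x ^ 3 = 1728) :
    (3 : ℕ) • (.some x y hp : W.toAffine.Point) = 0 := by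
  rw [three'_nsmul, add_self_eq_neg_of_cube h2F h3F h1 h2 h3 h4 h6 hp hx, neg_add_cancel]

omit h2F h3F h6 in
/-- `3•T = 0` for `T = (0, y)` (tangent slope `0`, `2T = −T`; the tree's
`SylvesterTwoCMNormForm.add_self_of_X_eq_zero`). [cite: HuShuYin2019, p. 7] -/
theorem three_nsmul_eq_zero_of_X_eq_zero {y : F} (hp : W.toAffine.Nonsingular 0 y) :
    (3 : ℕ) • (.some 0 y hp : W.toAffine.Point) = 0 := by
  rw [three'_nsmul, add_self_of_X_eq_zero h1 h2 h3 h4 hp, neg_add_cancel]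

/-! ## §3 `E₁[3]` is EXACTLY the nine points -/

/-- **Classification of `E₁[3]`**: an affine point `T = (x, y)` of `y² = x³ − 432` (over any field
with `2, 3 ≠ 0`) satisfies `3•T = 0` iff `x = 0` or `x³ = 1728`. (`⇒`: `2T = −T` forces `y ≠ −y` and
`x(2T) = x`, i.e. `L² = 3x` with `L·2y = 3x²`, whence `9x⁴ = 12x·y² = 12x(x³ − 432)`, i.e.
`3x(x³ − 1728) = 0`.) [cite: SilvermanAEC2009, III.2.3] -/
theorem three_nsmul_eq_zero_iff {x y : F} (hp : W.toAffine.Nonsingular x y) :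
    (3 : ℕ) • (.some x y hp : W.toAffine.Point) = 0 ↔ x = 0 ∨ x ^ 3 = 1728 := by
  constructor
  · intro hT
    rw [three'_nsmul, add_eq_zero_iff_eq_neg] at hT
    by_cases hy : y = W.toAffine.negY x y
    · rw [Affine.Point.add_self_of_Y_eq hy] at hT
      exact absurd (neg_eq_zero.mp hT.symm) (Affine.Point.some_ne_zero hp)
    · have heq := (equation_iff_mordell h1 h2 h3 h4 h6 x y).mp hp.left
      have hL := slope_self_mul h1 h2 h3 h4 hy
      set L := W.toAffine.slope x x y y with hLdef
      rw [Affine.Point.add_self_of_Y_ne' hy, neg_inj] at hT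
      simp only [Affine.addX, h1, h2, sub_zero, Affine.Point.some.injEq] at hT
      obtain ⟨hX, -⟩ := hT
      have hX' : L ^ 2 = 3 * x := by linear_combination hX
      have key : (3 : F) * x * (x ^ 3 - 1728) = 0 := by
        linear_combination (L * (2 * y) + 3 * x ^ 2) * hL + (-(4 * y ^ 2)) * hX' + (-(12 * x)) * heq
      rcases mul_eq_zero.mp key with h' | h'
      · exact Or.inl ((mul_eq_zero.mp h').resolve_left h3F)
      · exact Or.inr (sub_eq_zero.mp h')
  · rintro (hx | hx)
    · subst hx
      exact three_nsmul_eq_zero_of_X_eq_zero h1 h2 h3 h4 hp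
    · exact three_nsmul_eq_zero_of_cube h2F h3F h1 h2 h3 h4 h6 hp hx

/-- **`E₁[3] ⊂ E₁(ℚ(ω))`, explicitly**: a `3`-torsion affine point of `y² = x³ − 432` over ANY field
`F ∋ ω` (`2, 3 ≠ 0`) is one of the EIGHT points `(0, ±12(2ω+1))`, `(12ζ, ±36)` (`ζ = 1, ω, ω²`) —
so with `𝒪` the nine points of the memo's (C-d)₃ are all of `E₁[3](F̄)`.
[cite: HuShuYin2019, pp. 7–8] -/
theorem eq_of_three_nsmul_eq_zero (hω : ω ^ 2 + ω + 1 = 0) {x y : F} (hp : W.toAffine.Nonsingular x y)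
    (hT : (3 : ℕ) • (.some x y hp : W.toAffine.Point) = 0) :
    (x = 0 ∧ (y = 12 * (2 * ω + 1) ∨ y = -(12 * (2 * ω + 1)))) ∨
      ((x = 12 ∨ x = 12 * ω ∨ x = 12 * ω ^ 2) ∧ (y = 36 ∨ y = -36)) := by
  rcases (three_nsmul_eq_zero_iff h2F h3F h1 h2 h3 h4 h6 hp).mp hT with hx | hx
  · subst hx
    exact Or.inl ⟨rfl, Y_of_X_eq_zero h1 h2 h3 h4 h6 hω hp.left⟩
  · exact Or.inr ⟨(cube_eq_iff hω x).mp hx, Y_of_cube h1 h2 h3 h4 h6 hp.left hx⟩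

end Torsion

end Summit.BirchSwinnertonDyer.BirchSwinnertonDyer.Theorems.SylvesterTwoThmCTorsion

end
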